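import Summits.NavierStokesRegularity.NavierStokesRegularity.Theses.SelfMixingDichotomy
import Literature.Analysis.FluidPDE.SereginSverakPressureProofs
import Literature.Analysis.FluidPDE.SereginSverak2002PressureLowerBoundProofs
import Literature.Analysis.FluidPDE.LerayHopfTranslate
import Literature.Analysis.FluidPDE.KNSSTypeIIHolds

/-!
# Route SelfMixingDichotomy — `LocalToGlobal` (item stmt-NavierStokesRegularity-1425)

The glue support item of route `SelfMixingDichotomy`:

  if every classical Leray–Hopf solution of the unforced Navier–Stokes system with `ν = 1` on
  `ℝ³ × [0, T)` from a rapidly decaying datum is bounded on some backward cylinder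
  `(T − ρ², T) × B_ρ(x₀)` at every point `x₀` of the final slice, then for every `ν > 0` every
  such solution with viscosity `ν` extends smoothly past its final time
  (`HasSmoothExtensionPast ν 0 u T`, i.e. `NoBlowup`).

## Proof (bookkeeping over engines proved in the tree)

1. **Viscosity normalisation** (`selfMixingDichotomy_isBackwardBoundedAt_of_unitViscosity`): for
   `(u, p)` at viscosity `ν` on `[0, T)` the pair `v(s, x) = ν⁻¹u(s/ν, x)`, `π = ν⁻²p(s/ν, x)` is
   classical at viscosity `1` on `[0, νT)` (`IsClassicalNSSolutionOn.viscosityRescale_set`),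
   Leray–Hopf from the rapidly decaying datum `ν⁻¹u₀` (`IsLerayHopfOn.viscosityRescale`,
   `hasRapidSpatialDecay_const_smul`); the hypothesis bounds `v` on `(νT − r², νT) × B_r(x₀)`,
   hence `u` on `(T − r'², T) × B_{r'}(x₀)`, `r' = r / max(1, ν)` (Tao 2011, footnote 3; the
   pattern of `SereginSverak2002_pressureOneSidedBound.of_unitViscosity`).
2. **Strip bound** (`selfMixingDichotomy_bound_Ioo_of_isBackwardBoundedAt`): backward boundedness
   at every `(T, x₀)` gives a bound on `(δ, T) × ℝ³` for every `δ > 0` — far field by the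
   ε-regularity criterion on the tails of `∫∫ (|u|³ + |p̃|^{3/2})` (Caffarelli–Kohn–Nirenberg 1982
   §6 / Lemarié-Rieusset 2016 Thm. 14.4, the tree's `SereginSverak2002.farField_bound`), near field
   by compactness (`SereginSverak2002.nearField_bound`).
3. **Continuation** (`selfMixingDichotomy_hasSmoothExtensionPast_of_isBackwardBoundedAt`):
   restart at an energy-good time `s ∈ (0, T)` (`IsLerayHopfOn.exists_isLerayHopfOn_translate`);
   the translate `u(· + s)` is classical and Leray–Hopf on `[0, T − s)` and bounded there, so it
   extends past `T − s` (`hasSmoothExtensionPast_of_bounded_holds`, Robinson–Rodrigo–Sadowski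
   2016, Thm. 8.17, PROVED in the tree), and `HasSmoothExtensionPast.of_translate` glues the
   extension back to `u` (the pattern of
   `seregin_sverak_2002_withFinalEnergy.hasSmoothExtensionPast`).

No named fact is taken as a hypothesis: the theorem is unconditional.

## References

* L. Caffarelli, R. Kohn, L. Nirenberg, CPAM 35 (1982), §6 (regular points, ε-regularity).
* T. Tao, *Localisation and compactness properties of the Navier–Stokes global regularity
  problem*, Anal. PDE 6 (2013) = arXiv:1108.1165 (2011), footnote 3 (viscosity normalisation).
* J. C. Robinson, J. L. Rodrigo, W. Sadowski, *The Three-Dimensional Navier–Stokes Equations*,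
  CUP 2016, Thm. 8.17 (continuation of bounded Leray–Hopf solutions).
* J. Leray, Acta Math. 63 (1934), §20 (similarity), §III.
-/

noncomputable section

open Literature.Analysis.FluidPDE MeasureTheory Set Function Filter Topology Metric

namespace Summit.NavierStokesRegularity.NavierStokesRegularity.Theorems

/-! ### Step 1: viscosity normalisation of final-time local boundedness -/

/-- **Viscosity normalisation** (Tao 2011, footnote 3). If every `ν = 1` classical Leray–Hopf
solution on `[0, T)` from a rapidly decaying datum is bounded on some backward cylinder
`(T − ρ², T) × B_ρ(x₀)` at every `x₀`, then so is every such solution with viscosity `ν > 0`: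
rescale `v(s, x) = ν⁻¹u(s/ν, x)`, `π(s, x) = ν⁻²p(s/ν, x)` to viscosity `1` on `[0, νT)`
(`IsClassicalNSSolutionOn.viscosityRescale_set`, `IsLerayHopfOn.viscosityRescale`,
`hasRapidSpatialDecay_const_smul`), apply the hypothesis at `(νT, x₀)`, and transport the bound
back with radius `r / max(1, ν)` (pattern of
`SereginSverak2002_pressureOneSidedBound.of_unitViscosity`). -/
theorem selfMixingDichotomy_isBackwardBoundedAt_of_unitViscosity
    (h : ∀ T : ℝ, 0 < T →
      ∀ (u : ℝ → EuclideanSpace ℝ (Fin 3) → EuclideanSpace ℝ (Fin 3))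
        (p : ℝ → EuclideanSpace ℝ (Fin 3) → ℝ),
        IsClassicalNSSolutionOn (Ico 0 T) 1 0 u p → IsLerayHopfOn T 1 0 (u 0) u →
        HasRapidSpatialDecay (u 0) →
        ∀ x₀ : EuclideanSpace ℝ (Fin 3), ∃ ρ : ℝ, 0 < ρ ∧ ∃ M : ℝ,
          ∀ t ∈ Ioo (T - ρ ^ 2) T, ∀ x ∈ ball x₀ ρ, ‖u t x‖ ≤ M)
    {ν T : ℝ} (hν : 0 < ν) (hT : 0 < T)
    {u : ℝ → EuclideanSpace ℝ (Fin 3) → EuclideanSpace ℝ (Fin 3)}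
    {p : ℝ → EuclideanSpace ℝ (Fin 3) → ℝ}
    (hs : IsClassicalNSSolutionOn (Ico 0 T) ν 0 u p) (hLH : IsLerayHopfOn T ν 0 (u 0) u)
    (hd : HasRapidSpatialDecay (u 0)) (x₀ : EuclideanSpace ℝ (Fin 3)) :
    IsBackwardBoundedAt u T x₀ := by
  have hν0 : ν ≠ 0 := hν.ne'
  have hνi : 0 < ν⁻¹ := inv_pos.2 hν
  have hνT : 0 < ν * T := mul_pos hν hT
  -- the rescaled pair at viscosity `1` on `[0, νT)`
  set v : ℝ → EuclideanSpace ℝ (Fin 3) → EuclideanSpace ℝ (Fin 3) := timeRescale ν⁻¹ ν⁻¹ u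
    with hv
  set π : ℝ → EuclideanSpace ℝ (Fin 3) → ℝ := timeRescale ν⁻¹ (ν⁻¹ ^ 2) p with hπ
  have hslice : ∀ s, v s = ν⁻¹ • u (ν⁻¹ * s) := fun s => rfl
  have hmaps : MapsTo (fun s => ν⁻¹ * s) (Ico 0 (ν * T)) (Ico 0 T) := by
    intro s hs'
    refine ⟨mul_nonneg hνi.le hs'.1, ?_⟩
    calc ν⁻¹ * s < ν⁻¹ * (ν * T) := mul_lt_mul_of_pos_left hs'.2 hνi
      _ = T := by rw [← mul_assoc, inv_mul_cancel₀ hν0, one_mul]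
  have hs' : IsClassicalNSSolutionOn (Ico 0 (ν * T)) 1 0 v π := by
    have := hs.viscosityRescale_set hν0 hmaps (uniqueDiffOn_Ico 0 (ν * T))
    rwa [timeRescale_zero_force] at this
  have hv0 : v 0 = ν⁻¹ • u 0 := by rw [hslice, mul_zero]
  have hLH' : IsLerayHopfOn (ν * T) 1 0 (v 0) v := by
    have := hLH.viscosityRescale hνi
    rw [div_inv_eq_mul, mul_comm T ν, inv_mul_cancel₀ hν0, timeRescale_zero_force] at this
    rwa [hv0]
  have hd' : HasRapidSpatialDecay (v 0) := by
    rw [hv0]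
    exact SereginSverak2002_pressureOneSidedBound.hasRapidSpatialDecay_const_smul
      (hs.contDiff_velocity ⟨le_rfl, hT⟩) hd ν⁻¹
  -- backward boundedness of `v` at `(ν T, x₀)`
  obtain ⟨r, hr, C, hC⟩ := h (ν * T) hνT v π hs' hLH' hd' x₀
  -- transport back: radius `r' = r / max 1 ν`
  set m : ℝ := max 1 ν with hm
  have hm1 : 1 ≤ m := le_max_left _ _
  have hmν : ν ≤ m := le_max_right _ _
  have hm0 : 0 < m := by positivity
  refine ⟨r / m, by positivity, ν * C, fun t ht x hx => ?_⟩
  have hrm : r / m ≤ r := div_le_self hr.le hm1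
  have hsq : ν * (r / m) ^ 2 ≤ r ^ 2 := by
    rw [div_pow]
    have hm2 : ν ≤ m ^ 2 := hmν.trans (by nlinarith)
    calc ν * (r ^ 2 / m ^ 2) = ν / m ^ 2 * r ^ 2 := by ring
      _ ≤ 1 * r ^ 2 := by
          refine mul_le_mul_of_nonneg_right ?_ (sq_nonneg r)
          rw [div_le_one (by positivity)]; exact hm2
      _ = r ^ 2 := one_mul _
  have hts : ν * t ∈ Ioo (ν * T - r ^ 2) (ν * T) := by
    constructor
    · have h1 : ν * (T - t) < ν * (r / m) ^ 2 := mul_lt_mul_of_pos_left (by linarith [ht.1]) hν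
      nlinarith
    · exact mul_lt_mul_of_pos_left ht.2 hν
  have hxs : x ∈ ball x₀ r := ball_subset_ball hrm hx
  have key := hC (ν * t) hts x hxs
  rw [hslice, Pi.smul_apply, ← mul_assoc, inv_mul_cancel₀ hν0, one_mul, norm_smul,
    Real.norm_eq_abs, abs_of_pos hνi] at key
  exact (inv_mul_le_iff₀ hν).1 key

/-! ### Step 2: the strip bound from final-time local boundedness -/

/-- **Strip bound.** A classical solution on `[0, T)` (`ν > 0`, `T > 0`) which is Leray–Hopf on
`[0, T)` and backward bounded at every point `(T, x₀)` of the final slice is bounded on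
`(δ, T) × ℝ³` for every `δ > 0`: far field by the ε-regularity criterion applied to the tails of
the finite integral `∫∫ (|u|³ + |p̃|^{3/2})` over the slab (`SereginSverak2002.farField_bound`,
Lemarié-Rieusset 2016 Thm. 14.4 / CKN 1982 §6), near field `[δ, T] × B̄(0, R)` by compactness
and the local hypothesis at the final slice (`SereginSverak2002.nearField_bound`). -/
theorem selfMixingDichotomy_bound_Ioo_of_isBackwardBoundedAt {ν T : ℝ} (hν : 0 < ν) (hT : 0 < T)
    {u : ℝ → EuclideanSpace ℝ (Fin 3) → EuclideanSpace ℝ (Fin 3)}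
    {p : ℝ → EuclideanSpace ℝ (Fin 3) → ℝ}
    (hs : IsClassicalNSSolutionOn (Ico 0 T) ν 0 u p) (hLH : IsLerayHopfOn T ν 0 (u 0) u)
    (hloc : ∀ x₀ : EuclideanSpace ℝ (Fin 3), IsBackwardBoundedAt u T x₀) {δ : ℝ} (hδ : 0 < δ) :
    ∃ M : ℝ, ∀ t ∈ Ioo δ T, ∀ x, ‖u t x‖ ≤ M := by
  -- far field
  obtain ⟨R, M₁, hfar⟩ := SereginSverak2002.farField_bound hν hT hs hLH hδ
  -- near field
  obtain ⟨M₂, hnear⟩ := SereginSverak2002.nearField_bound hT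
    (SereginSverak2002.continuousOn_uncurry hs) hloc hδ R
  refine ⟨max M₁ M₂, fun t ht x => ?_⟩
  by_cases hx : ‖x‖ ≤ R
  · exact (hnear (t, x) ⟨⟨ht.1.le, ht.2.le⟩, mem_closedBall_zero_iff.2 hx⟩ ht.2).trans
      (le_max_right _ _)
  · exact (hfar t ht x (not_le.1 hx)).trans (le_max_left _ _)

/-! ### Step 3: continuation past the final time -/

/-- **Continuation.** A classical solution on `[0, T)` (`ν > 0`, `T > 0`) which is Leray–Hopf on
`[0, T)` and backward bounded at every point of the final slice extends smoothly past `T`: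
restart at an energy-good time `s ∈ (0, T)` (`IsLerayHopfOn.exists_isLerayHopfOn_translate`);
the translate `u(· + s)` is classical and Leray–Hopf on `[0, T − s)` and bounded there by the
strip bound with `δ = s/2`, so it extends past `T − s` by the continuation of bounded Leray–Hopf
solutions (`hasSmoothExtensionPast_of_bounded_holds`, Robinson–Rodrigo–Sadowski 2016 Thm. 8.17),
and the extension is glued back to `u` (`HasSmoothExtensionPast.of_translate`). -/
theorem selfMixingDichotomy_hasSmoothExtensionPast_of_isBackwardBoundedAt {ν T : ℝ} (hν : 0 < ν)
    (hT : 0 < T) {u : ℝ → EuclideanSpace ℝ (Fin 3) → EuclideanSpace ℝ (Fin 3)}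
    {p : ℝ → EuclideanSpace ℝ (Fin 3) → ℝ}
    (hs : IsClassicalNSSolutionOn (Ico 0 T) ν 0 u p) (hLH : IsLerayHopfOn T ν 0 (u 0) u)
    (hloc : ∀ x₀ : EuclideanSpace ℝ (Fin 3), IsBackwardBoundedAt u T x₀) :
    HasSmoothExtensionPast ν 0 u T := by
  -- an energy-good restarting time `s ∈ (0, T)`
  obtain ⟨s, hsI, hLHs⟩ := hLH.exists_isLerayHopfOn_translate hs hν.le hT le_rfl
  have hs2 : 0 < s / 2 := by linarith [hsI.1]
  obtain ⟨M, hM⟩ := selfMixingDichotomy_bound_Ioo_of_isBackwardBoundedAt hν hT hs hLH hloc hs2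
  -- the translate: classical on `[0, T - s)`, Leray–Hopf from `u s`, bounded on `[0, T - s) × ℝ³`
  have hsol' : IsClassicalNSSolutionOn (Ico 0 (T - s)) ν 0 (fun t => u (t + s))
      (fun t => p (t + s)) := hs.translate_Ico_zero hsI.1.le
  have hLHs' : IsLerayHopfOn (T - s) ν 0 ((fun t => u (t + s)) 0) (fun t => u (t + s)) := by
    show IsLerayHopfOn (T - s) ν 0 (u (0 + s)) (fun t => u (t + s))
    rw [zero_add]
    exact hLHs
  have hMs : ∃ M : ℝ, ∀ t ∈ Ico 0 (T - s), ∀ x, ‖(fun t => u (t + s)) t x‖ ≤ M :=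
    ⟨M, fun t ht x => hM (t + s) ⟨by linarith [ht.1, hsI.1], by linarith [ht.2]⟩ x⟩
  have hext : HasSmoothExtensionPast ν 0 (fun t => u (t + s)) (T - s) :=
    hasSmoothExtensionPast_of_bounded_holds hν (sub_pos.2 hsI.2) hsol' hLHs' hMs
  exact HasSmoothExtensionPast.of_translate hs hsI.1 hsI.2 hext

/-! ### The item -/

/-- **`LocalToGlobal`** (item stmt-NavierStokesRegularity-1425, support of route
`SelfMixingDichotomy`): if every `ν = 1` classical Leray–Hopf solution of the unforced
Navier–Stokes system on `ℝ³ × [0, T)` from a rapidly decaying datum is bounded on some backward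
cylinder `(T − ρ², T) × B_ρ(x₀)` at every `x₀`, then for every `ν > 0` every such solution with
viscosity `ν` extends smoothly past `T` (`HasSmoothExtensionPast ν 0 u T`). Proof: viscosity
normalisation of the local bound (Step 1), strip bound by far-field ε-regularity and compactness
(Step 2), continuation of bounded Leray–Hopf solutions after a restart at an energy-good time
(Step 3). Unconditional. -/
theorem selfMixingDichotomy_localToGlobal_proof :
    Summit.NavierStokesRegularity.NavierStokesRegularity.Theses.SelfMixingDichotomy.LocalToGlobal := by
  unfold Summit.NavierStokesRegularity.NavierStokesRegularity.Theses.SelfMixingDichotomy.LocalToGlobal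
  intro h ν T hν hT u p hs hLH hd
  exact selfMixingDichotomy_hasSmoothExtensionPast_of_isBackwardBoundedAt hν hT hs hLH
    (selfMixingDichotomy_isBackwardBoundedAt_of_unitViscosity h hν hT hs hLH hd)

end Summit.NavierStokesRegularity.NavierStokesRegularity.Theorems

end
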